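import Literature.AlgebraicGeometry.HodgeTheory.ComplexifiedDeRhamFamily
import Literature.AlgebraicGeometry.HodgeTheory.HodgeFiltrationModels
import Literature.AlgebraicGeometry.HodgeTheory.HodgeModelExistence
import Literature.AlgebraicGeometry.HodgeTheory.GysinFormalismHodge
import Literature.AlgebraicTopology.SingularHomology.CohomologyRingChange
import Literature.NumberTheory.Transcendental.ComplexFormsProofs
import Literature.NumberTheory.Transcendental.FormsAlgebraWedgeCommProofs
import Literature.NumberTheory.Transcendental.FormsAlgebraWedgeAssocProofs
import HarnessLib

/-!
# The cup product preserves Hodge types, from de Rham's theorem (multiplicative form)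

Family `hodge`, layer `Literature/AlgebraicGeometry/HodgeTheory`. Companion to `GysinFormalismHodge`
(the predicate `CupPreservesHodgeType n X`: "the cup product of a class of type `(p, q)` and a
class of type `(p', q')` is of type `(p + p', q + q')`", so far carried by its consumers —
`GysinFormalismHodge`, `MiddleDimensionReductionOfHodgeModels` (BFNP Lemma 48, lower half) — as an
explicit hypothesis). Printed content: C. Voisin, *Hodge Theory and Complex Algebraic Geometry I*
(2002), §5.3.2 Thm. 5.29 ("the cup product of de Rham classes is represented by the wedge product
of representing closed forms") with §2.3.1 / §7.1.2 (the wedge product of a `(p,q)`-form and a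
`(p',q')`-form is a `(p+p', q+q')`-form, "the operator `L` is of bidegree `(1,1)`").

This file PROVES `CupPreservesHodgeType n X` for `X` smooth projective with a Hodge model, from
two named facts of the tree:

* `Literature.NumberTheory.Transcendental.exists_deRhamIsoFamily 𝓘(ℝ, E)` (de Rham's theorem in
  its multiplicative form, Warner Thm. 5.36 / 5.45: a natural, MULTIPLICATIVE, normalised family
  `H^k_dR(–; ℝ) ≃ Hᵏ(–; ℝ)` over the manifolds charted on the model space `E`), and
* `hodgePQ_independent_of_hodgeModel` (all Hodge models of `X` cut out the same `H^{p,q}`;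
  `HodgeFiltrationModels`, reduced to the rigidity of natural de Rham comparisons in
  `HodgeFiltrationModelsRigidity`),

through the following steps (no named fact is introduced):

1. (forms) `Re(α ∧ β) = Re α ∧ Re β − Im α ∧ Im β`, `Im(α ∧ β) = Re α ∧ Im β + Im α ∧ Re β`
   (`MForm.re_wedge`, `MForm.im_wedge`; the shuffle formula and `Re(zw) = Re z Re w − Im z Im w`);
   the wedge of closed smooth complex forms is closed smooth (`wedge_mem_cclosedSmoothForms`).
2. (singular side) complexification of real classes `Hᵏ(M; ℝ) → Hᵏ(M; ℂ)` is multiplicative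
   (`ofRealClass_cupProduct`, from `singularCohomology.ringChange_cupProduct`).
3. (the comparison) for a MULTIPLICATIVE real family `e`, its complexification `e ⊗ ℂ`
   (`DeRhamIsoFamily.complexify`, file `ComplexifiedDeRhamFamily`: `c ↦ e(Re c) ⊗ 1 + i e(Im c) ⊗ 1`)
   is multiplicative on classes of closed complex forms:
   `(e ⊗ ℂ)[α ∧ β] = (e ⊗ ℂ)[α] ∪ (e ⊗ ℂ)[β]` (`complexifyFun_mk_wedge`).
4. (Hodge types) hence `(e ⊗ ℂ)(H^{p,q}) ∪ (e ⊗ ℂ)(H^{p',q'}) ⊆ (e ⊗ ℂ)(H^{p+p',q+q'})`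
   (`cupProduct_mem_map_hodgePQ`, by span induction; types add under `∧`, the tree's theorem
   `IsOfType.wedge_holds`).
5. (models) replacing the comparison family of a Hodge model `B` of `X` by `e ⊗ ℂ` gives a Hodge
   model again (the Hodge decomposition does not see the comparison; cf. `HodgeModel.induce`), in
   which step 4 is the claim; classes of given Hodge type in arbitrary models are moved into this
   model by `hodgePQ_independent_of_hodgeModel` (`cupPreservesHodgeType_of_exists_deRhamIsoFamily`,
   `cupPreservesHodgeType_of_nonempty_hodgeModel`).

## References

* [VoisinHodgeI2002] C. Voisin, Hodge Theory and Complex Algebraic Geometry I, CUP 2002, §2.3.1,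
  §5.3.2 Thm. 5.29, §6.1.3 Cor. 6.12, §7.1.2.
* [WarnerGTM94] F. W. Warner, Foundations of Differentiable Manifolds and Lie Groups, GTM 94
  (1983), 2.10(b), Thm. 5.36, Thm. 5.45.
* [HatcherAT2002] A. Hatcher, Algebraic Topology, CUP 2002, §3.2 (naturality of `∪` in the
  coefficients).
-/

noncomputable section

open scoped Manifold ContDiff
open Literature.AlgebraicTopology.SingularHomology
open Literature.NumberTheory.Transcendental (complexDeRhamCohomology hodgePQ IsOfType
  cclosedSmoothForms mem_cclosedSmoothForms_iff DeRhamIsoFamily WedgeFacts exists_deRhamIsoFamily)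
open Literature.Geometry.Kaehler (MForm deRhamCohomology closedSmoothForms)

namespace Literature.AlgebraicGeometry.HodgeTheory

section HodgeTheory

universe u

/-! ### Real and imaginary parts of a wedge product of complex forms -/

section Forms

variable {E : Type*} [NormedAddCommGroup E] [NormedSpace ℂ E]
  {M : Type*} [TopologicalSpace M] [ChartedSpace E M] {k l : ℕ}

/-- `Re(a ∧ b) = Re a ∧ Re b − Im a ∧ Im b` for complex-valued real-alternating maps on a real
normed space (the shuffle formula for `∧`, Warner 2.10(b), and `Re(zw) = Re z Re w − Im z Im w`
termwise). [cite: WarnerGTM94, 2.10(b)] -/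
theorem ContinuousAlternatingMap.re_wedge {V : Type*} [NormedAddCommGroup V] [NormedSpace ℝ V]
    (a : V [⋀^Fin k]→L[ℝ] ℂ) (b : V [⋀^Fin l]→L[ℝ] ℂ) :
    Complex.reCLM.compContinuousAlternatingMap (a.wedge b) =
      (Complex.reCLM.compContinuousAlternatingMap a).wedge (Complex.reCLM.compContinuousAlternatingMap b) -
        (Complex.imCLM.compContinuousAlternatingMap a).wedge (Complex.imCLM.compContinuousAlternatingMap b) := by
  ext v
  simp only [ContinuousLinearMap.compContinuousAlternatingMap_coe, Function.comp_apply,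
    ContinuousAlternatingMap.sub_apply, ContinuousAlternatingMap.wedge_apply, Complex.reCLM_apply,
    Complex.imCLM_apply, Complex.smul_re, Complex.re_sum, Units.smul_def, Complex.mul_re, smul_sub,
    Finset.sum_sub_distrib]

/-- `Im(a ∧ b) = Re a ∧ Im b + Im a ∧ Re b` for complex-valued real-alternating maps.
[cite: WarnerGTM94, 2.10(b)] -/
theorem ContinuousAlternatingMap.im_wedge {V : Type*} [NormedAddCommGroup V] [NormedSpace ℝ V]
    (a : V [⋀^Fin k]→L[ℝ] ℂ) (b : V [⋀^Fin l]→L[ℝ] ℂ) :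
    Complex.imCLM.compContinuousAlternatingMap (a.wedge b) =
      (Complex.reCLM.compContinuousAlternatingMap a).wedge (Complex.imCLM.compContinuousAlternatingMap b) +
        (Complex.imCLM.compContinuousAlternatingMap a).wedge (Complex.reCLM.compContinuousAlternatingMap b) := by
  ext v
  simp only [ContinuousLinearMap.compContinuousAlternatingMap_coe, Function.comp_apply,
    ContinuousAlternatingMap.add_apply, ContinuousAlternatingMap.wedge_apply, Complex.reCLM_apply,
    Complex.imCLM_apply, Complex.smul_im, Complex.im_sum, Units.smul_def, Complex.mul_im, smul_add,
    Finset.sum_add_distrib]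

/-- **`Re(α ∧ β) = Re α ∧ Re β − Im α ∧ Im β`** for complex forms on a manifold (pointwise
`ContinuousAlternatingMap.re_wedge`). [cite: WarnerGTM94, 2.10(b)] [cite: VoisinHodgeI2002, §2.3.1] -/
theorem _root_.Literature.Geometry.Kaehler.MForm.re_wedge (α : MForm 𝓘(ℝ, E) M ℂ k)
    (β : MForm 𝓘(ℝ, E) M ℂ l) : (α.wedge β).re = α.re.wedge β.re - α.im.wedge β.im :=
  funext fun x ↦ ContinuousAlternatingMap.re_wedge (V := E) (α x) (β x)

/-- **`Im(α ∧ β) = Re α ∧ Im β + Im α ∧ Re β`** for complex forms on a manifold.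
[cite: WarnerGTM94, 2.10(b)] [cite: VoisinHodgeI2002, §2.3.1] -/
theorem _root_.Literature.Geometry.Kaehler.MForm.im_wedge (α : MForm 𝓘(ℝ, E) M ℂ k)
    (β : MForm 𝓘(ℝ, E) M ℂ l) : (α.wedge β).im = α.re.wedge β.im + α.im.wedge β.re :=
  funext fun x ↦ ContinuousAlternatingMap.im_wedge (V := E) (α x) (β x)

/-- The wedge product of closed smooth complex forms is a closed smooth complex form (Leibniz
rule; membership in `Z^•(M; ℂ)` is "smooth and closed", `mem_cclosedSmoothForms_iff`).
[cite: WarnerGTM94, Thm. 2.20(2)] -/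
theorem wedge_mem_cclosedSmoothForms [IsManifold 𝓘(ℝ, E) ∞ M] [WedgeFacts 𝓘(ℝ, E) M ℂ]
    {α : MForm 𝓘(ℝ, E) M ℂ k} {β : MForm 𝓘(ℝ, E) M ℂ l} (hα : α ∈ cclosedSmoothForms E M k)
    (hβ : β ∈ cclosedSmoothForms E M l) : α.wedge β ∈ cclosedSmoothForms E M (k + l) := by
  rw [mem_cclosedSmoothForms_iff] at hα hβ ⊢
  exact Literature.NumberTheory.Transcendental.wedge_mem_closedSmoothForms (I := 𝓘(ℝ, E)) (A := ℂ)
    (show α ∈ closedSmoothForms 𝓘(ℝ, E) M ℂ k from hα) (show β ∈ closedSmoothForms 𝓘(ℝ, E) M ℂ l from hβ)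

end Forms

/-! ### Complexification of real singular classes is multiplicative -/

section Singular

variable {Y : Type u} [TopologicalSpace Y]

/-- `a ⊗ 1` is the change of coefficient ring along `ℝ →+* ℂ` (both are post-composition of
cocycles with `Complex.ofReal`). [cite: HatcherAT2002, §3.1 p. 198] -/
theorem ofRealClass_eq_ringChange {k : ℕ} (a : singularCohomology ℝ ℝ Y k) :
    ofRealClass Y k a = singularCohomology.ringChange Complex.ofRealHom Y k a := by
  induction a using singularCohomology_induction_on with
  | h z =>
    rw [ofRealClass_π, singularCohomology.ringChange_π]
    congr 1

/-- **`(a ∪ b) ⊗ 1 = (a ⊗ 1) ∪ (b ⊗ 1)`**: complexification `Hᵏ(Y; ℝ) → Hᵏ(Y; ℂ)` is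
multiplicative (the cup product is natural in the coefficient ring). [cite: HatcherAT2002, §3.2 p. 215] -/
theorem ofRealClass_cupProduct {p q m : ℕ} (h : p + q = m) (a : singularCohomology ℝ ℝ Y p)
    (b : singularCohomology ℝ ℝ Y q) :
    ofRealClass Y m (cupProduct h a b) = cupProduct h (ofRealClass Y p a) (ofRealClass Y q b) := by
  rw [ofRealClass_eq_ringChange, ofRealClass_eq_ringChange, ofRealClass_eq_ringChange,
    singularCohomology.ringChange_cupProduct]

end Singular

/-! ### The complexification of a multiplicative real family is multiplicative -/

section Complexify

variable {E : Type u} [NormedAddCommGroup E] [NormedSpace ℂ E]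
  {M : Type u} [TopologicalSpace M] [ChartedSpace E M] [IsManifold 𝓘(ℝ, E) ∞ M]
  [T2Space M] [SigmaCompactSpace M] [WedgeFacts 𝓘(ℝ, E) M ℝ] [WedgeFacts 𝓘(ℝ, E) M ℂ]
  {e : DeRhamIsoFamily 𝓘(ℝ, E)} (he : e.IsMultiplicative) {k l : ℕ}

include he in
/-- **`(e ⊗ ℂ)[α ∧ β] = (e ⊗ ℂ)[α] ∪ (e ⊗ ℂ)[β]`** for closed smooth complex forms `α`, `β` and a
MULTIPLICATIVE real de Rham isomorphism family `e` (`e ⊗ ℂ = complexifyFun e`: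
`c ↦ e(Re c) ⊗ 1 + i e(Im c) ⊗ 1`): expand `α = Re α + i Im α`, `β = Re β + i Im β`, use
`Re(α ∧ β) = Re α ∧ Re β − Im α ∧ Im β`, `Im(α ∧ β) = Re α ∧ Im β + Im α ∧ Re β`, the
multiplicativity of `e` (`e[a ∧ b] = e[a] ∪ e[b]`, Warner Thm. 5.45) and of `⊗ 1`, and the
bilinearity of `∪` over `ℂ`. [cite: WarnerGTM94, Thm. 5.45] [cite: VoisinHodgeI2002, §5.3.2 Thm. 5.29 and §6.1.3 Cor. 6.12] -/
theorem complexifyFun_mk_wedge (α : cclosedSmoothForms E M k) (β : cclosedSmoothForms E M l) :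
    complexifyFun e (k + l) (complexDeRhamCohomology.mk E M (k + l)
        ⟨(α : MForm 𝓘(ℝ, E) M ℂ k).wedge (β : MForm 𝓘(ℝ, E) M ℂ l),
          wedge_mem_cclosedSmoothForms α.2 β.2⟩) =
      cupProduct rfl (complexifyFun e k (complexDeRhamCohomology.mk E M k α))
        (complexifyFun e l (complexDeRhamCohomology.mk E M l β)) := by
  -- the real closed forms `Re α, Im α, Re β, Im β`
  set a₁ : closedSmoothForms 𝓘(ℝ, E) M ℝ k :=
    ⟨(α : MForm 𝓘(ℝ, E) M ℂ k).re, Literature.NumberTheory.Transcendental.re_mem_closedSmoothForms α.2⟩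
  set a₂ : closedSmoothForms 𝓘(ℝ, E) M ℝ k :=
    ⟨(α : MForm 𝓘(ℝ, E) M ℂ k).im, Literature.NumberTheory.Transcendental.im_mem_closedSmoothForms α.2⟩
  set b₁ : closedSmoothForms 𝓘(ℝ, E) M ℝ l :=
    ⟨(β : MForm 𝓘(ℝ, E) M ℂ l).re, Literature.NumberTheory.Transcendental.re_mem_closedSmoothForms β.2⟩
  set b₂ : closedSmoothForms 𝓘(ℝ, E) M ℝ l :=
    ⟨(β : MForm 𝓘(ℝ, E) M ℂ l).im, Literature.NumberTheory.Transcendental.im_mem_closedSmoothForms β.2⟩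
  -- real and imaginary parts of `[α ∧ β]` as real cup products
  have hre : complexDeRhamCohomology.re E M (k + l) (complexDeRhamCohomology.mk E M (k + l)
      ⟨(α : MForm 𝓘(ℝ, E) M ℂ k).wedge (β : MForm 𝓘(ℝ, E) M ℂ l),
        wedge_mem_cclosedSmoothForms α.2 β.2⟩) =
      deRhamCohomology.cup rfl (deRhamCohomology.mk a₁) (deRhamCohomology.mk b₁) -
        deRhamCohomology.cup rfl (deRhamCohomology.mk a₂) (deRhamCohomology.mk b₂) := by
    rw [complexDeRhamCohomology.re_mk, deRhamCohomology.cup_mk_mk, deRhamCohomology.cup_mk_mk,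
      ← map_sub]
    refine congrArg _ (Subtype.ext ?_)
    rw [Submodule.coe_sub, deRhamCohomology.coe_closedWedge, deRhamCohomology.coe_closedWedge,
      Literature.Geometry.Kaehler.MForm.castDeg_rfl, Literature.Geometry.Kaehler.MForm.castDeg_rfl]
    exact Literature.Geometry.Kaehler.MForm.re_wedge _ _
  have him : complexDeRhamCohomology.im E M (k + l) (complexDeRhamCohomology.mk E M (k + l)
      ⟨(α : MForm 𝓘(ℝ, E) M ℂ k).wedge (β : MForm 𝓘(ℝ, E) M ℂ l),
        wedge_mem_cclosedSmoothForms α.2 β.2⟩) =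
      deRhamCohomology.cup rfl (deRhamCohomology.mk a₁) (deRhamCohomology.mk b₂) +
        deRhamCohomology.cup rfl (deRhamCohomology.mk a₂) (deRhamCohomology.mk b₁) := by
    rw [complexDeRhamCohomology.im_mk, deRhamCohomology.cup_mk_mk, deRhamCohomology.cup_mk_mk,
      ← map_add]
    refine congrArg _ (Subtype.ext ?_)
    rw [Submodule.coe_add, deRhamCohomology.coe_closedWedge, deRhamCohomology.coe_closedWedge,
      Literature.Geometry.Kaehler.MForm.castDeg_rfl, Literature.Geometry.Kaehler.MForm.castDeg_rfl]
    exact Literature.Geometry.Kaehler.MForm.im_wedge _ _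
  -- the real side: `e` and `⊗ 1` are multiplicative
  have eRe : ofRealClass M (k + l) (e M (k + l)
      (deRhamCohomology.cup rfl (deRhamCohomology.mk a₁) (deRhamCohomology.mk b₁) -
        deRhamCohomology.cup rfl (deRhamCohomology.mk a₂) (deRhamCohomology.mk b₂))) =
      cupProduct rfl (ofRealClass M k (e M k (deRhamCohomology.mk a₁)))
          (ofRealClass M l (e M l (deRhamCohomology.mk b₁))) -
        cupProduct rfl (ofRealClass M k (e M k (deRhamCohomology.mk a₂)))
          (ofRealClass M l (e M l (deRhamCohomology.mk b₂))) := by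
    rw [map_sub, he M k l (k + l) rfl, he M k l (k + l) rfl, map_sub, ofRealClass_cupProduct,
      ofRealClass_cupProduct]
  have eIm : ofRealClass M (k + l) (e M (k + l)
      (deRhamCohomology.cup rfl (deRhamCohomology.mk a₁) (deRhamCohomology.mk b₂) +
        deRhamCohomology.cup rfl (deRhamCohomology.mk a₂) (deRhamCohomology.mk b₁))) =
      cupProduct rfl (ofRealClass M k (e M k (deRhamCohomology.mk a₁)))
          (ofRealClass M l (e M l (deRhamCohomology.mk b₂))) +
        cupProduct rfl (ofRealClass M k (e M k (deRhamCohomology.mk a₂)))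
          (ofRealClass M l (e M l (deRhamCohomology.mk b₁))) := by
    rw [map_add, he M k l (k + l) rfl, he M k l (k + l) rfl, map_add, ofRealClass_cupProduct,
      ofRealClass_cupProduct]
  have hα' : complexifyFun e k (complexDeRhamCohomology.mk E M k α) =
      ofRealClass M k (e M k (deRhamCohomology.mk a₁)) +
        Complex.I • ofRealClass M k (e M k (deRhamCohomology.mk a₂)) := by
    rw [complexifyFun, complexDeRhamCohomology.re_mk, complexDeRhamCohomology.im_mk]
  have hβ' : complexifyFun e l (complexDeRhamCohomology.mk E M l β) =
      ofRealClass M l (e M l (deRhamCohomology.mk b₁)) +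
        Complex.I • ofRealClass M l (e M l (deRhamCohomology.mk b₂)) := by
    rw [complexifyFun, complexDeRhamCohomology.re_mk, complexDeRhamCohomology.im_mk]
  -- expand both sides: bilinearity of `∪` over `ℂ` and `i² = -1`
  rw [complexifyFun, hre, him, eRe, eIm, hα', hβ']
  simp only [map_add, LinearMap.add_apply, map_smul, LinearMap.smul_apply, smul_add,
    smul_smul, Complex.I_mul_I, neg_one_smul]
  abel

include he in
/-- **`(e ⊗ ℂ)(H^{p,q}) ∪ (e ⊗ ℂ)(H^{p',q'}) ⊆ (e ⊗ ℂ)(H^{p+p',q+q'})`**: for a multiplicative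
real de Rham isomorphism family `e`, the cup product of the images under `e ⊗ ℂ` of classes of
closed forms of types `(p, q)` and `(p', q')` is the image of a class of type `(p+p', q+q')` — the
wedge of the representatives ("the wedge product of a `(p,q)`-form with a `(p',q')`-form is a
`(p+p', q+q')`-form", `IsOfType.wedge_holds`; span induction on both arguments).
[cite: VoisinHodgeI2002, §2.3.1 and §7.1.2] [cite: WarnerGTM94, Thm. 5.45] -/
theorem cupProduct_mem_map_hodgePQ {p q p' q' : ℕ} {u : complexDeRhamCohomology E M k}
    {v : complexDeRhamCohomology E M l} (hu : u ∈ hodgePQ E M k p q) (hv : v ∈ hodgePQ E M l p' q') :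
    cupProduct rfl (complexifyFun e k u) (complexifyFun e l v) ∈
      (hodgePQ E M (k + l) (p + p') (q + q')).map (e.complexifyEquiv M (k + l)).toLinearMap := by
  have h0k : complexifyFun e k (0 : complexDeRhamCohomology E M k) = 0 := (e.complexifyEquiv M k).map_zero
  have h0l : complexifyFun e l (0 : complexDeRhamCohomology E M l) = 0 := (e.complexifyEquiv M l).map_zero
  induction hu using Submodule.span_induction with
  | mem u hu =>
    obtain ⟨α, hα, rfl⟩ := hu
    induction hv using Submodule.span_induction with
    | mem v hv =>
      obtain ⟨β, hβ, rfl⟩ := hv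
      refine ⟨complexDeRhamCohomology.mk E M (k + l) ⟨(α : MForm 𝓘(ℝ, E) M ℂ k).wedge
        (β : MForm 𝓘(ℝ, E) M ℂ l), wedge_mem_cclosedSmoothForms α.2 β.2⟩,
        Submodule.subset_span ⟨_, Literature.NumberTheory.Transcendental.IsOfType.wedge_holds hα hβ, rfl⟩,
        ?_⟩
      rw [LinearEquiv.coe_coe, complexifyEquiv_apply]
      exact complexifyFun_mk_wedge he α β
    | zero =>
      rw [h0l, map_zero]
      exact Submodule.zero_mem _
    | add v v' _ _ hv hv' =>
      rw [complexifyFun_add, map_add]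
      exact Submodule.add_mem _ hv hv'
    | smul c v _ hv =>
      rw [complexifyFun_smul, map_smul]
      exact Submodule.smul_mem _ c hv
  | zero =>
    rw [h0k, map_zero, LinearMap.zero_apply]
    exact Submodule.zero_mem _
  | add u u' _ _ hu hu' =>
    rw [complexifyFun_add, map_add, LinearMap.add_apply]
    exact Submodule.add_mem _ hu hu'
  | smul c u _ hu =>
    rw [complexifyFun_smul, map_smul, LinearMap.smul_apply]
    exact Submodule.smul_mem _ c hu

end Complexify


/-! ### Hodge models with a multiplicative comparison; the cup product preserves Hodge types -/

section Models

variable {n : ℕ} {X : Motives.SchemeOver ℂ}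

/-- **The cup product preserves Hodge types, from de Rham's theorem (multiplicative form).** For
`X` smooth projective of dimension `n` with a Hodge model `B`, granted de Rham's theorem on the
manifolds charted on the model space of `B` (`exists_deRhamIsoFamily`: a natural, multiplicative,
normalised real family `e`) and `hodgePQ_independent_of_hodgeModel`: the cup product of a class of
Hodge type `(p, q)` and a class of Hodge type `(p', q')` is of Hodge type `(p + p', q + q')`
(`CupPreservesHodgeType n X`). In the Hodge model `B'` obtained from `B` by replacing its
comparison family with `e ⊗ ℂ` (natural, `DeRhamIsoFamily.complexify_isNatural`; the Hodge
decomposition of `B` is untouched), both classes are `(e ⊗ ℂ)`-images of `H^{p,q}`, `H^{p',q'}`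
(independence of the model), and `(e ⊗ ℂ)(H^{p,q}) ∪ (e ⊗ ℂ)(H^{p',q'}) ⊆ (e ⊗ ℂ)(H^{p+p',q+q'})`
(`cupProduct_mem_map_hodgePQ`: the cup product of de Rham classes is the class of the wedge,
Thm. 5.29, and types add under `∧`, §7.1.2). [cite: VoisinHodgeI2002, §5.3.2 Thm. 5.29 and §7.1.2]
[cite: WarnerGTM94, Thm. 5.36 / Thm. 5.45] -/
theorem cupPreservesHodgeType_of_exists_deRhamIsoFamily (hI : hodgePQ_independent_of_hodgeModel)
    (hX : Motives.IsSmoothProjective n X) (B : HodgeModel n X)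
    (hdR : exists_deRhamIsoFamily 𝓘(ℝ, B.model)) : CupPreservesHodgeType n X := by
  obtain ⟨e, he, hem, -⟩ := hdR
  -- the Hodge model `B'` with comparison `e ⊗ ℂ`
  let B' : HodgeModel n X :=
    { B with
      deRham := e.complexify
      deRham_isNatural := DeRhamIsoFamily.complexify_isNatural he }
  haveI : WedgeFacts 𝓘(ℝ, B.model) B.carrier ℝ :=
    Literature.NumberTheory.Transcendental.wedgeFacts_of_assoc 𝓘(ℝ, B.model) B.carrier ℝ
      (ContinuousAlternatingMap.WedgeAssoc_holds ℝ B.model ℝ)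
  haveI : WedgeFacts 𝓘(ℝ, B.model) B.carrier ℂ :=
    Literature.NumberTheory.Transcendental.wedgeFacts_of_assoc 𝓘(ℝ, B.model) B.carrier ℂ
      (ContinuousAlternatingMap.WedgeAssoc_holds ℝ B.model ℂ)
  intro k l s h p q p' q' a b ha hb
  subst h
  -- move both classes into `B'`
  have ha' : B'.pullback k a ∈ B'.hodgePQ k p q := (hI.isOfHodgeType_iff hX B').1 ha
  have hb' : B'.pullback l b ∈ B'.hodgePQ l p' q' := (hI.isOfHodgeType_iff hX B').1 hb
  obtain ⟨u, hu, hua⟩ := Submodule.mem_map.1 ha'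
  obtain ⟨v, hv, hvb⟩ := Submodule.mem_map.1 hb'
  refine ⟨B', ?_⟩
  change B'.pullback (k + l) (cupProduct rfl a b) ∈
    (hodgePQ B.model B.carrier (k + l) (p + p') (q + q')).map (e.complexifyEquiv B.carrier (k + l)).toLinearMap
  have hcup : B'.pullback (k + l) (cupProduct rfl a b) =
      cupProduct rfl (B'.pullback k a) (B'.pullback l b) := cupProduct_map _ rfl a b
  rw [hcup, ← hua, ← hvb]
  exact cupProduct_mem_map_hodgePQ hem hu hv

/-- **`CupPreservesHodgeType n X` from the named facts** `nonempty_hodgeModel n X`,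
`hodgePQ_independent_of_hodgeModel` and de Rham's theorem `exists_deRhamIsoFamily` (for every
finite-dimensional complex model space) — the form in which the consumers' hypothesis "the cup
product preserves Hodge types" is discharged. [cite: VoisinHodgeI2002, §5.3.2 Thm. 5.29 and §7.1.2]
[cite: WarnerGTM94, Thm. 5.36 / Thm. 5.45] -/
theorem cupPreservesHodgeType_of_nonempty_hodgeModel (hI : hodgePQ_independent_of_hodgeModel)
    (hA : nonempty_hodgeModel n X)
    (hdR : ∀ (E : Type) [NormedAddCommGroup E] [NormedSpace ℂ E] [FiniteDimensional ℂ E],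
      exists_deRhamIsoFamily 𝓘(ℝ, E))
    (hX : Motives.IsSmoothProjective n X) : CupPreservesHodgeType n X := by
  obtain ⟨B⟩ := hA.nonempty hX
  exact cupPreservesHodgeType_of_exists_deRhamIsoFamily hI hX B (hdR B.model)

end Models

end HodgeTheory

end Literature.AlgebraicGeometry.HodgeTheory

end
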